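import Summits.ValiantsHypothesis.ValiantsHypothesis.Theorems.SymPencilPerFourHyperplaneFlowTwoRows
import Summits.ValiantsHypothesis.ValiantsHypothesis.Theorems.SymPencilPerFourHyperplaneFlowBlocksRowZero

/-!
# Route `SymPencil` — exact flows of `per [v; ·]` on a ONE-ROW hyperplane: reduction to block-diagonal (R1) data
# (tool file for the one-row defect-2 cell `(12,4,2)` of `sdc(per_4)`, `--supports`
# stmt-ValiantsHypothesis-5674; nothing here bears on `VP ≠ VNP`)

The remaining case of val-width-5674-w2 g2's hyperplane flow rigidity (RIG) after
`SymPencilPerFourHyperplaneFlowTwoRows` (linear form non-zero on two rows) and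
`SymPencilPerFourHyperplaneFlow.exists_good_point_of_flow_zero` (`ℓ = 0`): the linear form `ℓ` is supported on
ONE row `a` (`ℓ(e_a ⊗ t) = 1`, `ℓ(e_b ⊗ ·) = 0` for `b ≠ a`), i.e. `ker ℓ = {y : μ(y_a) = 0}`.  Then the flow on
`ker ℓ` forces every off-diagonal block of `X` to be `u_b ⊗ ℓ` or `0` (`offDiag_row0` for the blocks INTO row `a`,
`offDiag_config` with compensating row `a` for the others), so `X` agrees on `ker ℓ` with a BLOCK-DIAGONAL map
`y ↦ (Y₀ y₀, Y₁ y₁, Y₂ y₂)`: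

* **`exists_blockDiag_of_flow_one_row`** — `∃ Y, ∀ y ∈ ker ℓ, X y = (Y_i y_i)_i`, and the exact flow holds for the
  block-diagonal map on `ker ℓ` (this is the «R1 data» of CELL-TWELVE-FOUR.md §3 S1b / the R1-CORE of §2(c):
  `T((1+tY_b) y_b, (1+tY_{b'}) y_{b'}, y_a + t Y_a y_a) = T(y_b, y_{b'}, y_a)` for `μ(y_a) = 0`).
* `exists_good_point_of_blockDiag_good_point` — a good point of the block-diagonal data is a good point of `X`
  (the return direction for the line's S1c).

Elementary; no definitions, no named facts. [folklore]
-/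

noncomputable section

-- single-conjunct layout: Sub = Summit, duplicated namespace component intended
set_option linter.dupNamespace false

namespace Summit.ValiantsHypothesis.ValiantsHypothesis.Theorems.SymPencilPerFourHyperplaneFlow

open Matrix
open Summit.ValiantsHypothesis.ValiantsHypothesis.Theorems.SymPencilPerFourInnerRankRows
open Summit.ValiantsHypothesis.ValiantsHypothesis.Theorems.SymPencilPerFourRowForms
open Summit.ValiantsHypothesis.ValiantsHypothesis.Theorems.SymPencilPerFourRowNoLinearFactor
open Summit.ValiantsHypothesis.ValiantsHypothesis.Theorems.SymPencilPerFourHyperplaneFlowBlocks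

variable {K : Type*} [Field K]

/-- **One-row hyperplane, row `0`.**  If `ℓ(e₀ ⊗ t) = 1` and `ℓ` vanishes on the rows `1, 2`, an exact flow symmetry
`X` on `ker ℓ` agrees there with a block-diagonal map. [folklore] -/
theorem exists_blockDiag_of_flow_one_row_row0 [CharZero K] {v : Fin 4 → K} (hv : ∀ j, v j ≠ 0)
    (X : (Fin 3 → Fin 4 → K) →ₗ[K] (Fin 3 → Fin 4 → K)) (ℓ : (Fin 3 → Fin 4 → K) →ₗ[K] K)
    (t : Fin 4 → K) (ht : ℓ (Pi.single 0 t) = 1)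
    (h1 : ∀ r : Fin 4 → K, ℓ (Pi.single 1 r) = 0) (h2 : ∀ r : Fin 4 → K, ℓ (Pi.single 2 r) = 0)
    (h : ∀ y, ℓ y = 0 → ∀ s : K,
      (Matrix.of ![v, (y + s • X y) 0, (y + s • X y) 1, (y + s • X y) 2]).permanent =
        (Matrix.of ![v, y 0, y 1, y 2]).permanent) :
    ∃ Y : Fin 3 → (Fin 4 → K) →ₗ[K] (Fin 4 → K), ∀ y, ℓ y = 0 → ∀ i, X y i = Y i (y i) := by
  classical
  have hD : ∀ y, ℓ y = 0 →
      (Matrix.of ![v, X y 0, y 1, y 2]).permanent + (Matrix.of ![v, y 0, X y 1, y 2]).permanent +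
        (Matrix.of ![v, y 0, y 1, X y 2]).permanent = 0 := fun y hy => (flow_orders v y _ (h y hy)).1
  -- blocks into row 0 vanish
  obtain ⟨u₀, h01, h02⟩ := offDiag_row0 hv X ℓ t ht hD
  -- blocks into rows 1 and 2
  let π₁ : Equiv.Perm (Fin 3) := Equiv.swap 0 2 * Equiv.swap 0 1
  let π₂ : Equiv.Perm (Fin 3) := Equiv.swap 0 2
  have hπ₁ : π₁ 0 = 1 ∧ π₁ 1 = 2 ∧ π₁ 2 = 0 := by decide
  have hπ₂ : π₂ 0 = 2 ∧ π₂ 1 = 1 ∧ π₂ 2 = 0 := by decide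
  obtain ⟨h12, h10⟩ := offDiag_config hv X ℓ π₁ t (by rw [hπ₁.2.2]; exact ht) h
  obtain ⟨h21, h20⟩ := offDiag_config hv X ℓ π₂ t (by rw [hπ₂.2.2]; exact ht) h
  rw [hπ₁.1, hπ₁.2.1, hπ₁.2.2] at h12
  rw [hπ₁.1, hπ₁.2.2] at h10
  rw [hπ₂.1, hπ₂.2.1, hπ₂.2.2] at h21
  rw [hπ₂.1, hπ₂.2.2] at h20
  -- the correction and the block-diagonal map
  set u : Fin 3 → Fin 4 → K := ![0, X (Pi.single 0 t) 1, X (Pi.single 0 t) 2] with hu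
  have hu1 : u 1 = X (Pi.single 0 t) 1 := rfl
  have hu2 : u 2 = X (Pi.single 0 t) 2 := rfl
  set X' : (Fin 3 → Fin 4 → K) →ₗ[K] (Fin 3 → Fin 4 → K) := X - ℓ.smulRight u with hX'
  have hX'app : ∀ y a, X' y a = X y a - ℓ y • u a := fun y a => by
    rw [hX', LinearMap.sub_apply, LinearMap.smulRight_apply, Pi.sub_apply, Pi.smul_apply]
  have hoff : ∀ (b a : Fin 3) (r : Fin 4 → K), a ≠ b → X' (Pi.single b r) a = 0 := by
    intro b a r hab
    rw [hX'app]
    have h3 : ∀ c : Fin 3, c = 0 ∨ c = 1 ∨ c = 2 := by decide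
    rcases h3 a with rfl | rfl | rfl <;> rcases h3 b with rfl | rfl | rfl
    all_goals first
      | exact absurd rfl hab
      | (rw [h01, h1, zero_smul, zero_smul, sub_zero])
      | (rw [h02, h2, zero_smul, zero_smul, sub_zero])
      | (rw [h10, hu1, sub_self])
      | (rw [h12, h2, zero_smul, zero_smul, sub_zero])
      | (rw [h20, hu2, sub_self])
      | (rw [h21, h1, zero_smul, zero_smul, sub_zero])
  let Y : Fin 3 → (Fin 4 → K) →ₗ[K] (Fin 4 → K) := fun a =>
    (LinearMap.proj a) ∘ₗ X' ∘ₗ LinearMap.single K (fun _ : Fin 3 => Fin 4 → K) a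
  have hY : ∀ a r, Y a r = X' (Pi.single a r) a := fun _ _ => rfl
  have hXd : ∀ y a, X' y a = Y a (y a) := by
    intro y a
    have hy : X' y = ∑ b, X' (Pi.single b (y b)) := by
      conv_lhs => rw [← Finset.univ_sum_single y]
      rw [map_sum]
    rw [hy, Finset.sum_apply, Fin.sum_univ_three, hY]
    have h3 : ∀ c : Fin 3, c = 0 ∨ c = 1 ∨ c = 2 := by decide
    rcases h3 a with rfl | rfl | rfl
    · rw [hoff 1 0 _ (by decide), hoff 2 0 _ (by decide), add_zero, add_zero]
    · rw [hoff 0 1 _ (by decide), hoff 2 1 _ (by decide), zero_add, add_zero]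
    · rw [hoff 0 2 _ (by decide), hoff 1 2 _ (by decide), zero_add, zero_add]
  refine ⟨Y, fun y hy i => ?_⟩
  rw [← hXd, hX'app, hy, zero_smul, sub_zero]

/-- **One-row hyperplane: the exact flow is carried by block-diagonal (R1) data.**  If `ℓ(e_a ⊗ t) = 1` and `ℓ`
vanishes on the other two rows (all `v_j ≠ 0`, characteristic `0`), an exact flow symmetry `X` on `ker ℓ` agrees
on `ker ℓ` with a block-diagonal map `y ↦ (Y_i y_i)_i`, which therefore has the exact flow on `ker ℓ` too.
[folklore] -/
theorem exists_blockDiag_of_flow_one_row [CharZero K] {v : Fin 4 → K} (hv : ∀ j, v j ≠ 0)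
    (X : (Fin 3 → Fin 4 → K) →ₗ[K] (Fin 3 → Fin 4 → K)) (ℓ : (Fin 3 → Fin 4 → K) →ₗ[K] K)
    (a : Fin 3) (t : Fin 4 → K) (ht : ℓ (Pi.single a t) = 1)
    (hrow : ∀ b : Fin 3, b ≠ a → ∀ r : Fin 4 → K, ℓ (Pi.single b r) = 0)
    (h : ∀ y, ℓ y = 0 → ∀ s : K,
      (Matrix.of ![v, (y + s • X y) 0, (y + s • X y) 1, (y + s • X y) 2]).permanent =
        (Matrix.of ![v, y 0, y 1, y 2]).permanent) :
    ∃ Y : Fin 3 → (Fin 4 → K) →ₗ[K] (Fin 4 → K),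
      (∀ y, ℓ y = 0 → ∀ i, X y i = Y i (y i)) ∧
      (∀ y : Fin 3 → Fin 4 → K, ℓ y = 0 → ∀ s : K,
        (Matrix.of ![v, y 0 + s • Y 0 (y 0), y 1 + s • Y 1 (y 1), y 2 + s • Y 2 (y 2)]).permanent =
          (Matrix.of ![v, y 0, y 1, y 2]).permanent) := by
  classical
  -- a row permutation with `π 0 = a`
  obtain ⟨π, hπ⟩ : ∃ π : Equiv.Perm (Fin 3), π 0 = a := by
    have h3 : ∀ c : Fin 3, c = 0 ∨ c = 1 ∨ c = 2 := by decide
    rcases h3 a with rfl | rfl | rfl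
    exacts [⟨1, by decide⟩, ⟨Equiv.swap 0 1, by decide⟩, ⟨Equiv.swap 0 2, by decide⟩]
  have hflow := flow_transport v X ℓ π h
  set T : (Fin 3 → Fin 4 → K) →ₗ[K] (Fin 3 → Fin 4 → K) := LinearMap.funLeft K (Fin 4 → K) π.symm with hT
  set Ti : (Fin 3 → Fin 4 → K) →ₗ[K] (Fin 3 → Fin 4 → K) := LinearMap.funLeft K (Fin 4 → K) π with hTi
  have hsingle : ∀ (i : Fin 3) (r : Fin 4 → K), T (Pi.single i r) = Pi.single (π i) r := fun i r => by
    rw [hT, funLeft_symm_single]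
  have ht' : (ℓ ∘ₗ T) (Pi.single 0 t) = 1 := by rw [LinearMap.comp_apply, hsingle, hπ, ht]
  have h1' : ∀ r : Fin 4 → K, (ℓ ∘ₗ T) (Pi.single 1 r) = 0 := fun r => by
    rw [LinearMap.comp_apply, hsingle]
    exact hrow _ (fun e => absurd (π.injective (e.trans hπ.symm)) (by decide)) r
  have h2' : ∀ r : Fin 4 → K, (ℓ ∘ₗ T) (Pi.single 2 r) = 0 := fun r => by
    rw [LinearMap.comp_apply, hsingle]
    exact hrow _ (fun e => absurd (π.injective (e.trans hπ.symm)) (by decide)) r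
  obtain ⟨Y', hY'⟩ := exists_blockDiag_of_flow_one_row_row0 hv (Ti ∘ₗ X ∘ₗ T) (ℓ ∘ₗ T) t ht' h1' h2' hflow
  -- back to the original rows: `Y j = Y' (π⁻¹ j)`
  have hTTi : ∀ y : Fin 3 → Fin 4 → K, T (Ti y) = y := fun y => by
    funext i; rw [hT, LinearMap.funLeft_apply, hTi, LinearMap.funLeft_apply, Equiv.apply_symm_apply]
  have hXY : ∀ y, ℓ y = 0 → ∀ j, X y j = Y' (π.symm j) (y j) := by
    intro y hy j
    have hy' : (ℓ ∘ₗ T) (Ti y) = 0 := by rw [LinearMap.comp_apply, hTTi]; exact hy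
    have e := hY' (Ti y) hy' (π.symm j)
    rw [LinearMap.comp_apply, LinearMap.comp_apply, hTTi, hTi, LinearMap.funLeft_apply, LinearMap.funLeft_apply,
      Equiv.apply_symm_apply] at e
    exact e
  refine ⟨fun j => Y' (π.symm j), hXY, fun y hy s => ?_⟩
  have e := h y hy s
  have hc : ∀ i, (y + s • X y) i = y i + s • Y' (π.symm i) (y i) := fun i => by
    rw [Pi.add_apply, Pi.smul_apply, hXY y hy i]
  rw [hc, hc, hc] at e
  exact e

/-- **Return direction.**  A good point of the block-diagonal data is a good point of `X`. [folklore] -/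
theorem exists_good_point_of_blockDiag_good_point {v : Fin 4 → K}
    (X : (Fin 3 → Fin 4 → K) →ₗ[K] (Fin 3 → Fin 4 → K)) (ℓ : (Fin 3 → Fin 4 → K) →ₗ[K] K)
    (Y : Fin 3 → (Fin 4 → K) →ₗ[K] (Fin 4 → K)) (hXY : ∀ y, ℓ y = 0 → ∀ i, X y i = Y i (y i))
    (hgood : ∃ y, ℓ y = 0 ∧ (∀ i, Y i (y i) = 0) ∧ (Matrix.of ![v, y 0, y 1, y 2]).permanent ≠ 0) :
    ∃ y, ℓ y = 0 ∧ X y = 0 ∧ (Matrix.of ![v, y 0, y 1, y 2]).permanent ≠ 0 := by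
  obtain ⟨y, hy, hY, hF⟩ := hgood
  exact ⟨y, hy, funext fun i => by rw [hXY y hy i, hY i, Pi.zero_apply], hF⟩

end Summit.ValiantsHypothesis.ValiantsHypothesis.Theorems.SymPencilPerFourHyperplaneFlow

end
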